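import Summits.AtomisticToContinuum.Crystallization.Theses.PhononSlackCertificates
import Summits.AtomisticToContinuum.Crystallization.Theorems.ReggeStarCoercivityDefectFreeCrystallizesSqueezeToLayeredA
import Summits.AtomisticToContinuum.Crystallization.Theorems.ReggeStarCoercivityStarCoercivityTwoShellGoodStarGood
import Summits.AtomisticToContinuum.Crystallization.Theorems.PhononSlackCertificatesHullBridgeWindows

/-!
# `HullBridge` (route `PhononSlackCertificates`), line `Sketch`: stub S5 `stub_windowsOfGluing`
# (crux stmt-AtomisticToContinuum-15147) — windows from gluing, one spacing for all scales

Along a Lennard-Jones ground-state sequence `x N`, suppose that for every tolerance `η > 0` and radius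
`R'`, for all large `N`, some particle has every particle within `R'` of it crux-good and `η`-layered
(`hcentre`, stub S3 of the line). Then the GLUING LEMMA `PrestressSplitKorn.LayeredGluing` (stub S4,
consumed here as a hypothesis), applied at such a centre with the `1/3`-separation of ground states
(`LennardJonesMinimalDistance_holds`), gives for each scale `(R, ε)` an `(R, ε)`-window of SOME in-layer
spacing `a ∈ [47/50, 1]`, eventually in `N`. The abstract accumulation-point lemma
`hb_exists_global_spacing` of part 1 (`PhononSlackCertificatesHullBridgeWindows`), fed with
`hb_window_mono`, `hb_window_neg`, `hb_window_rescale`, then yields ONE spacing serving every scale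
frequently in `N` — the matrix of `HullBridge` for the sequence. No new definitions.
-/

noncomputable section

open scoped BigOperators Classical
open Filter Topology

namespace Summit.AtomisticToContinuum.Crystallization.Theorems.HullBridgeExact

open Summit.AtomisticToContinuum.Crystallization.Theses.PhononSlackCertificates
open Summit.AtomisticToContinuum.Crystallization.Theorems.PrestressSplitKorn
open Summit.AtomisticToContinuum.Crystallization.Theorems.DefectFreeCrystallizes.Negative.PredicateAPI (Good)
open Literature.MathematicalPhysics.StatisticalMechanics Literature.Geometry.DiscreteGeometry

local notation "E3" => EuclideanSpace ℝ (Fin 3)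

/-- The labelled layered set `range (l ↦ A (layeredPos a s z l))` of the gluing lemma is the set-builder
layered set `{A (i u(a) + j v(a) + L_s(m) w(a) + z m e₃)}` of the window clause (`l = (m, i, j)`). -/
theorem wg_range_layeredPos_eq (A : E3 →ₗᵢ[ℝ] E3) (a : ℝ) (s : ℤ → ℤ) (z : ℤ → ℝ) :
    (Set.range fun l : ℤ × ℤ × ℤ => A (layeredPos a s z l)) =
      {p | ∃ m i j : ℤ, p = A (((i : ℝ) • triangularVec₁ a) +
        ((j : ℝ) • triangularVec₂ a) + ((haggLabel s m : ℝ) • barlowOffset a) +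
        (z m • layerNormal 1))} := by
  ext p
  constructor
  · rintro ⟨l, rfl⟩
    exact ⟨l.1, l.2.1, l.2.2, rfl⟩
  · rintro ⟨m, i, j, rfl⟩
    exact ⟨(m, i, j), rfl⟩

/-- **Windows of some spacing, eventually.** The gluing lemma at a clean centre: for each scale `(R, ε)`,
for all large `N`, the configuration `x N` carries an `(R, ε)`-window of SOME spacing `a ∈ [47/50, 1]`. -/
theorem wg_eventually_window (hG : LayeredGluing) (x : (N : ℕ) → (Fin N → E3))
    (hx : ∀ N, IsGroundState lennardJones (x N))
    (hcentre : ∀ η : ℝ, 0 < η → ∀ R' : ℝ, ∀ᶠ N : ℕ in atTop, ∃ i : Fin N, ∀ j : Fin N,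
      dist (x N j) (x N i) ≤ R' → Good (x N) j ∧ LayeredNear η (x N) j)
    (R ε : ℝ) (hε : 0 < ε) :
    ∀ᶠ N : ℕ in atTop, ∃ a : ℝ, a ∈ Set.Icc (47 / 50 : ℝ) 1 ∧
      ∃ (A : E3 →ₗᵢ[ℝ] E3) (t : E3) (s : ℤ → ℤ) (z : ℤ → ℝ), IsHaggSeq s ∧
        (∀ m : ℤ, 39 / 50 * a ≤ z (m + 1) - z m ∧ z (m + 1) - z m ≤ 17 / 20 * a) ∧
        let S : Set E3 := {p | ∃ m i j : ℤ, p = A (((i : ℝ) • triangularVec₁ a) +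
          ((j : ℝ) • triangularVec₂ a) + ((haggLabel s m : ℝ) • barlowOffset a) +
          (z m • layerNormal 1))}
        (∀ p ∈ S, ‖p‖ ≤ R → ∃ i : Fin N, dist (x N i + t) p ≤ ε) ∧
          (∀ i : Fin N, ‖x N i + t‖ ≤ R → ∃ p ∈ S, dist (x N i + t) p ≤ ε) := by
  obtain ⟨δ, hδ, hsepall⟩ := LennardJonesMinimalDistance_holds
  obtain ⟨η, hη, R', hglue⟩ := hG δ hδ R ε hε
  filter_upwards [hcentre η hη R'] with N hN
  obtain ⟨i, hi⟩ := hN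
  obtain ⟨A, t, a, s, z, hbox, hs, h12⟩ := hglue N (x N) (hsepall N (x N) (hx N)) i hi
  dsimp only at h12
  rw [wg_range_layeredPos_eq] at h12
  exact ⟨a, ⟨hbox.1, hbox.2.1⟩, A, t, s, z, hs, hbox.2.2, h12⟩

/-- **S5 — windows from gluing.** Clean centres at every `(η, R')` plus the gluing lemma give, per
ground-state sequence, ONE in-layer spacing `a ∈ [47/50, 1]` and `(R, ε)`-windows frequently in `N` for
every scale (the conclusion of `HullBridge` for that sequence): windows of some spacing eventually
(`wg_eventually_window`), then compactness in the spacing (`hb_exists_global_spacing` with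
`hb_window_mono`, `hb_window_neg`, `hb_window_rescale`). -/
theorem stub_windowsOfGluing (hG : LayeredGluing) (x : (N : ℕ) → (Fin N → E3))
    (hx : ∀ N, IsGroundState lennardJones (x N))
    (hcentre : ∀ η : ℝ, 0 < η → ∀ R' : ℝ, ∀ᶠ N : ℕ in atTop, ∃ i : Fin N, ∀ j : Fin N,
      dist (x N j) (x N i) ≤ R' → Good (x N) j ∧ LayeredNear η (x N) j) :
    ∃ a : ℝ, 47 / 50 ≤ a ∧ a ≤ 1 ∧ ∀ R ε : ℝ, 0 < ε → ∃ᶠ N in Filter.atTop,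
      ∃ (A : E3 →ₗᵢ[ℝ] E3) (t : E3) (s : ℤ → ℤ) (z : ℤ → ℝ), IsHaggSeq s ∧
        (∀ m : ℤ, 39 / 50 * a ≤ z (m + 1) - z m ∧ z (m + 1) - z m ≤ 17 / 20 * a) ∧
        let S : Set E3 := {p | ∃ m i j : ℤ, p = A (((i : ℝ) • triangularVec₁ a) +
          ((j : ℝ) • triangularVec₂ a) + ((haggLabel s m : ℝ) • barlowOffset a) + (z m • layerNormal 1))}
        (∀ p ∈ S, ‖p‖ ≤ R → ∃ i : Fin N, dist (x N i + t) p ≤ ε) ∧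
          (∀ i : Fin N, ‖x N i + t‖ ≤ R → ∃ p ∈ S, dist (x N i + t) p ≤ ε) := by
  -- the set of admissible spacings of `(R, ε)`-windows of `x N`
  let W : ℕ → ℝ → ℝ → Set ℝ := fun N R ε =>
    {a | a ∈ Set.Icc (47 / 50 : ℝ) 1 ∧
      ∃ (A : E3 →ₗᵢ[ℝ] E3) (t : E3) (s : ℤ → ℤ) (z : ℤ → ℝ), IsHaggSeq s ∧
        (∀ m : ℤ, 39 / 50 * a ≤ z (m + 1) - z m ∧ z (m + 1) - z m ≤ 17 / 20 * a) ∧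
        let S : Set E3 := {p | ∃ m i j : ℤ, p = A (((i : ℝ) • triangularVec₁ a) +
          ((j : ℝ) • triangularVec₂ a) + ((haggLabel s m : ℝ) • barlowOffset a) +
          (z m • layerNormal 1))}
        (∀ p ∈ S, ‖p‖ ≤ R → ∃ i : Fin N, dist (x N i + t) p ≤ ε) ∧
          (∀ i : Fin N, ‖x N i + t‖ ≤ R → ∃ p ∈ S, dist (x N i + t) p ≤ ε)}
  have hbox : ∀ N R ε, W N R ε ⊆ Set.Icc (47 / 50 : ℝ) 1 := fun N R ε a ha => ha.1
  have hmono : ∀ N R R₂ ε ε₂, R₂ ≤ R → ε ≤ ε₂ → W N R ε ⊆ W N R₂ ε₂ :=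
    fun N R R₂ ε ε₂ hR hε a ha => ⟨ha.1, hb_window_mono (x N) hR hε ha.2⟩
  have hneg : ∀ N R ε a, R < 0 → a ∈ Set.Icc (47 / 50 : ℝ) 1 → a ∈ W N R ε :=
    fun N R ε a hR ha => ⟨ha, hb_window_neg (x N) hR (by linarith [ha.1])⟩
  have hresc : ∀ N R ε a a', 0 ≤ R → 0 < ε → a' ∈ W N (2 * R + 1) (ε / 2) →
      a ∈ Set.Icc (47 / 50 : ℝ) 1 → |a - a'| ≤ ε / (8 * (R + 1)) → a ∈ W N R ε :=
    fun N R ε a a' hR hε ha' ha haa =>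
      ⟨ha, hb_window_rescale (x N) hR hε ha.1 ha.2 ha'.1.1 ha'.1.2 haa ha'.2⟩
  have hne : ∀ R ε, 0 < ε → ∀ᶠ N in atTop, (W N R ε).Nonempty := fun R ε hε =>
    (wg_eventually_window hG x hx hcentre R ε hε).mono fun N ⟨a, ha, hW⟩ => ⟨a, ha, hW⟩
  obtain ⟨a, ha, hwin⟩ := hb_exists_global_spacing W hbox hmono hneg hresc hne
  exact ⟨a, ha.1, ha.2, fun R ε hε => (hwin R ε hε).mono fun N hN => hN.2⟩

/-- **Landing anchor of this file** (registered on crux stmt-AtomisticToContinuum-15147; notation-free and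
`let`-free, so that the registry holds its full text): re-exports `stub_windowsOfGluing` verbatim, with the
layered set `S` of the window clause written out in place of the `let`. -/
theorem hullBridge_windowsOfGluing_anchor :
    LayeredGluing → ∀ x : (N : ℕ) → (Fin N → EuclideanSpace ℝ (Fin 3)),
      (∀ N, IsGroundState lennardJones (x N)) →
      (∀ η : ℝ, 0 < η → ∀ R' : ℝ, ∀ᶠ N : ℕ in atTop, ∃ i : Fin N, ∀ j : Fin N,
        dist (x N j) (x N i) ≤ R' → Good (x N) j ∧ LayeredNear η (x N) j) →
      ∃ a : ℝ, 47 / 50 ≤ a ∧ a ≤ 1 ∧ ∀ R ε : ℝ, 0 < ε → ∃ᶠ N in Filter.atTop,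
        ∃ (A : EuclideanSpace ℝ (Fin 3) →ₗᵢ[ℝ] EuclideanSpace ℝ (Fin 3)) (t : EuclideanSpace ℝ (Fin 3))
          (s : ℤ → ℤ) (z : ℤ → ℝ), IsHaggSeq s ∧
          (∀ m : ℤ, 39 / 50 * a ≤ z (m + 1) - z m ∧ z (m + 1) - z m ≤ 17 / 20 * a) ∧
          (∀ p ∈ {p : EuclideanSpace ℝ (Fin 3) | ∃ m i j : ℤ, p = A (((i : ℝ) • triangularVec₁ a) +
              ((j : ℝ) • triangularVec₂ a) + ((haggLabel s m : ℝ) • barlowOffset a) + (z m • layerNormal 1))},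
            ‖p‖ ≤ R → ∃ i : Fin N, dist (x N i + t) p ≤ ε) ∧
          (∀ i : Fin N, ‖x N i + t‖ ≤ R →
            ∃ p ∈ {p : EuclideanSpace ℝ (Fin 3) | ∃ m i j : ℤ, p = A (((i : ℝ) • triangularVec₁ a) +
              ((j : ℝ) • triangularVec₂ a) + ((haggLabel s m : ℝ) • barlowOffset a) + (z m • layerNormal 1))},
              dist (x N i + t) p ≤ ε) :=
  fun hG x hx hcentre => stub_windowsOfGluing hG x hx hcentre

end Summit.AtomisticToContinuum.Crystallization.Theorems.HullBridgeExact

end
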